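import Literature.AlgebraicGeometry.ComplexMultiplication.EndomorphismFieldDeterminantCondition
import Mathlib.GroupTheory.CosetCover
import Mathlib.LinearAlgebra.Dual.Lemmas
import HarnessLib

/-!
# Kottwitz's lemma «`V ≅ W` iff `det_V = det_W`» for `F ⊗ ℂ` and its use on Shimura's pair:
# the `Φ`-determinant condition DETERMINES the type `Φ`

Topic `Literature/AlgebraicGeometry/ComplexMultiplication` (family `hodge`, lane `lit-hodgefound`; the ALGEBRAIC
carrier `Motives.AbelianVariety ℂ`, Shimura's pairs `(A, ι : F →+* A.endAlgebra)`, `[F : ℚ] = 2 dim A`, THE type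
`Φ = cmTypeOfPair ι hF`).  Sequel of `EndomorphismFieldDeterminantCondition` (g26-#10: the pair satisfies Howard's
`Φ`-determinant condition `det(∑ Tᵢ xᵢ | 𝔪_e/𝔪_e²) = ∏_{φ ∈ Φ} (∑ Tᵢ φ(xᵢ))` for every finite family and basis).
Here: the determinant polynomial of a `ℚ`-SPANNING family DETERMINES the multiplicities of the embeddings — the
case `E = F`, `k = ℂ` (so `E ⊗ k = ℂ × ⋯ × ℂ` indexed by `Hom(F, ℂ)`) of Kottwitz's lemma — hence a pair satisfying
the `Ψ`-determinant condition for a set `Ψ` of embeddings has `Ψ = Φ`: the datum «CM type `Φ`» in Howard's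
`𝒞ℳ_Φ` is recovered from the determinant condition.

PRINTED STATEMENTS.  R. Kottwitz, *Points on some Shimura varieties over finite fields*, JAMS 5 (1992)
[Kottwitz1992], §5 p. 390 (held text `paper:doi-10-2307-2152772` p. 18): «Let `E` be a finite-dimensional
semisimple algebra over a field `k`, and let `α₁, …, α_t` be a `k`-basis for `E`. For any finite-dimensional
`E`-module `V` define a polynomial `det_V ∈ k[X₁, …, X_t]` by `det_V = det(X₁α₁ + ⋯ + X_tα_t ; V ⊗_k k[X₁, …, X_t])`.
Then `V` is isomorphic to `W` if and only if `det_V = det_W`. … The proof is easy: replacing `E` by its center and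
`k` by its algebraic closure, it is enough to prove the statement for `E = k × ⋯ × k`, in which case it is
obvious.»  B. Howard [Howard2012] Def. 3.1.1 (the `Φ`-determinant condition defining `𝒞ℳ_Φ^𝔞`).  For `E = F` a
number field and `k = ℂ`: `F ⊗_ℚ ℂ ≅ ∏_{φ : F → ℂ} ℂ`, a module is `⊕_φ ℂ_φ^{m_φ}`, and for a `ℚ`-spanning family
`x₁, …, x_t` of `F` (a `ℂ`-spanning family of `F ⊗ ℂ`) `det_V = ∏_φ (∑ᵢ Xᵢ φ(xᵢ))^{m_φ}`; «obvious» = distinct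
embeddings give pairwise non-proportional linear forms, and a product of powers of pairwise non-proportional
linear forms determines the exponents.

WHAT IS PROVED:

* §1 (`F` a number field, `x : ι → F` with `Submodule.span ℚ (range x) = ⊤`; private steps: the linear form
  `ℓ_φ = ∑ᵢ Xᵢ·φ(xᵢ) ∈ ℂ[Xᵢ]` is non-zero; HYPERPLANE AVOIDANCE `exists_root_avoiding` — a point of `ker ℓ_{φ₀}`
  outside every `ker ℓ_ψ`, `ψ ≠ φ₀` (Mathlib: a complex vector space is not a finite union of proper subspaces,
  `Subspace.exists_eq_top_of_iUnion_eq_univ`; nested kernels of functionals are proportional,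
  `mem_span_of_iInf_ker_le_ker`; proportional embeddings agreeing on a `ℚ`-spanning set are equal))
  **`eq_of_prod_linearForm_pow_eq`** — KOTTWITZ'S LEMMA for `F ⊗ ℂ`:
  `∏_φ ℓ_φ^{m_φ} = ∏_φ ℓ_φ^{m'_φ} ⟹ m = m'` (induction on `∑ m`, evaluating at an avoiding point and cancelling
  one factor `ℓ_{φ₀}` in the domain `ℂ[Xᵢ]`).
* §2 on Shimura's pair: **`eq_indicator_of_det_sum_X_smul_eq_prod_pow`** — if the determinant polynomial of a
  `ℚ`-spanning family `x` (lifts `u i ∈ End A`, any basis of `𝔪_e/𝔪_e²`) equals `∏_φ ℓ_φ^{m_φ}`, then `m` is the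
  indicator of `Φ = cmTypeOfPair ι hF`; **`eq_cmTypeOfPair_of_det_sum_X_smul_eq_prod`** — a pair satisfying the
  `Ψ`-determinant condition (on a spanning family) for a set `Ψ` of embeddings has `Ψ = Φ`.

Theorems only; no definition, no named fact, no `sorry` (net debt 0); axioms `propext`, `Classical.choice`,
`Quot.sound`.

## References
* [Kottwitz1992] R. E. Kottwitz, *Points on some Shimura varieties over finite fields*, J. Amer. Math. Soc. 5 (1992),
  §5, p. 390 (the lemma «`V ≅ W` iff `det_V = det_W`»).
* [Howard2012] B. Howard, *Complex multiplication cycles and Kudla–Rapoport divisors*, Ann. of Math. (2) 176 (2012),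
  Def. 3.1.1 and §3.1.
* [Shimura1998] G. Shimura, *Abelian Varieties with Complex Multiplication and Modular Functions* (1998), §5.2 p. 39.

## Provenance

Lane `lit-hodgefound` (HOME `run/shared/lean/pub/lit-hodgefound/`), prover seat `lit-hodgefound-p11` (gen 26),
self-proposed row g26-#13 (INBOX claim 2026-08-27).
-/

noncomputable section

namespace Literature.AlgebraicGeometry.ComplexMultiplication

open scoped Classical
open CategoryTheory NumberField Module
open Literature.AlgebraicGeometry.Motives
open Literature.NumberTheory.ComplexMultiplication

/-! ### §1 Kottwitz's lemma for `F ⊗ ℂ`: a product of powers of the embedding linear forms determines the exponents -/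

section Kottwitz

variable {F : Type} [Field F] [NumberField F] {ι : Type} [Fintype ι] (x : ι → F)

omit [NumberField F] in
/-- Evaluation of the linear form `ℓ_φ = ∑ᵢ Xᵢ·φ(xᵢ)` at a point `v ∈ ℂ^ι`. [folklore] -/
private theorem eval_linearForm (φ : F →+* ℂ) (v : ι → ℂ) :
    MvPolynomial.eval v (∑ i, (MvPolynomial.X i : MvPolynomial ι ℂ) * MvPolynomial.C (φ (x i) : ℂ)) =
      ∑ i, v i * φ (x i) := by
  rw [map_sum]
  refine Finset.sum_congr rfl fun i _ => ?_
  rw [map_mul, MvPolynomial.eval_X, MvPolynomial.eval_C]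

omit [Fintype ι] in
/-- A `ℚ`-spanning family of the field `F ≠ 0` has a non-zero member. [folklore] -/
private theorem exists_apply_ne_zero (hx : Submodule.span ℚ (Set.range x) = ⊤) : ∃ i, x i ≠ 0 := by
  by_contra h
  push Not at h
  have h1 : (1 : F) ∈ Submodule.span ℚ (Set.range x) := hx ▸ Submodule.mem_top
  rw [Submodule.span_eq_bot.2 (by rintro _ ⟨i, rfl⟩; exact h i), Submodule.mem_bot] at h1
  exact one_ne_zero h1

/-- The linear form `ℓ_φ` of a spanning family is non-zero (evaluate at a coordinate vector). [folklore] -/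
private theorem linearForm_ne_zero (hx : Submodule.span ℚ (Set.range x) = ⊤) (φ : F →+* ℂ) :
    (∑ i, (MvPolynomial.X i : MvPolynomial ι ℂ) * MvPolynomial.C (φ (x i) : ℂ)) ≠ 0 := by
  obtain ⟨i, hi⟩ := exists_apply_ne_zero x hx
  intro h0
  have h := congrArg (MvPolynomial.eval (Pi.single i (1 : ℂ))) h0
  rw [eval_linearForm, map_zero,
    Fintype.sum_eq_single i (fun j hj => by rw [Pi.single_eq_of_ne hj, zero_mul]), Pi.single_eq_same,
    one_mul] at h
  exact (map_ne_zero φ).2 hi h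

omit [NumberField F] in
/-- Evaluation of `∑ᵢ vᵢ ψ(xᵢ)` at a coordinate vector. [folklore] -/
private theorem sum_single_mul (ψ : F →+* ℂ) (i : ι) : ∑ j, (Pi.single i (1 : ℂ) : ι → ℂ) j * ψ (x j) = ψ (x i) := by
  rw [Fintype.sum_eq_single i (fun j hj => by rw [Pi.single_eq_of_ne hj, zero_mul]), Pi.single_eq_same, one_mul]

/-- **Distinct embeddings give non-proportional linear forms**: if `ker ℓ_{φ₀} ⊆ ker ℓ_ψ` (as functionals on `ℂ^ι`)
then `ψ = φ₀` — nested kernels make `ℓ_ψ = c·ℓ_{φ₀}`, so `ψ = c·φ₀` on the `ℚ`-span of the family, which is `F ∋ 1`.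
[cite: Kottwitz1992, §5 (p. 390, «in which case it is obvious»)] -/
private theorem eq_of_ker_le_ker (hx : Submodule.span ℚ (Set.range x) = ⊤) {φ₀ ψ : F →+* ℂ}
    (hle : LinearMap.ker (Fintype.linearCombination ℂ fun i => (φ₀ (x i) : ℂ)) ≤
      LinearMap.ker (Fintype.linearCombination ℂ fun i => (ψ (x i) : ℂ))) : ψ = φ₀ := by
  have hL : ∀ (χ : F →+* ℂ) (v : ι → ℂ),
      Fintype.linearCombination ℂ (fun i => (χ (x i) : ℂ)) v = ∑ i, v i * χ (x i) := fun χ v => by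
    simp only [Fintype.linearCombination_apply, smul_eq_mul]
  have hmem : Fintype.linearCombination ℂ (fun i => (ψ (x i) : ℂ)) ∈
      Submodule.span ℂ (Set.range fun _ : Unit => Fintype.linearCombination ℂ fun i => (φ₀ (x i) : ℂ)) :=
    mem_span_of_iInf_ker_le_ker (ι := Unit) (by rwa [iInf_const])
  rw [Set.range_const, Submodule.mem_span_singleton] at hmem
  obtain ⟨c, hc⟩ := hmem
  have hval : ∀ i, (ψ (x i) : ℂ) = c * φ₀ (x i) := fun i => by
    have h := LinearMap.congr_fun hc (Pi.single i 1)
    rw [LinearMap.smul_apply, hL, hL, sum_single_mul, sum_single_mul, smul_eq_mul] at h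
    exact h.symm
  have hlin : ∀ y ∈ Submodule.span ℚ (Set.range x), (ψ y : ℂ) = c * φ₀ y := by
    intro y hy
    induction hy using Submodule.span_induction with
    | mem y hy =>
      obtain ⟨i, rfl⟩ := hy
      exact hval i
    | zero => simp
    | add y z _ _ hy hz => rw [map_add, map_add, hy, hz, mul_add]
    | smul q y _ hy => rw [map_rat_smul, map_rat_smul, hy, Rat.smul_def, Rat.smul_def, mul_left_comm]
  have h1 : (1 : ℂ) = c := by
    have h := hlin 1 (hx ▸ Submodule.mem_top)
    rwa [map_one, map_one, mul_one] at h
  refine RingHom.ext fun y => ?_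
  have h := hlin y (hx ▸ Submodule.mem_top)
  rwa [← h1, one_mul] at h

/-- **HYPERPLANE AVOIDANCE**: there is `v ∈ ℂ^ι` with `ℓ_{φ₀}(v) = 0` and `ℓ_ψ(v) ≠ 0` for every `ψ ≠ φ₀` — the
hyperplane `ker ℓ_{φ₀}` is not the union of its proper subspaces `ker ℓ_{φ₀} ∩ ker ℓ_ψ` (`ℂ` is infinite).
[cite: Kottwitz1992, §5 (p. 390)] -/
private theorem exists_root_avoiding (hx : Submodule.span ℚ (Set.range x) = ⊤) (φ₀ : F →+* ℂ) :
    ∃ v : ι → ℂ, ∑ i, v i * φ₀ (x i) = 0 ∧ ∀ ψ : F →+* ℂ, ψ ≠ φ₀ → ∑ i, v i * ψ (x i) ≠ 0 := by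
  have hL : ∀ (χ : F →+* ℂ) (v : ι → ℂ),
      Fintype.linearCombination ℂ (fun i => (χ (x i) : ℂ)) v = ∑ i, v i * χ (x i) := fun χ v => by
    simp only [Fintype.linearCombination_apply, smul_eq_mul]
  by_contra hno
  push Not at hno
  set K₀ : Submodule ℂ (ι → ℂ) := LinearMap.ker (Fintype.linearCombination ℂ fun i => (φ₀ (x i) : ℂ)) with hK₀
  let P : {ψ : F →+* ℂ // ψ ≠ φ₀} → Submodule ℂ K₀ := fun ψ =>
    (LinearMap.ker (Fintype.linearCombination ℂ fun i => (ψ.1 (x i) : ℂ))).comap K₀.subtype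
  have hcov : ⋃ ψ, (P ψ : Set K₀) = Set.univ := by
    refine Set.eq_univ_of_forall fun v => ?_
    have hv : ∑ i, v.1 i * φ₀ (x i) = 0 := by
      rw [← hL]
      exact v.2
    obtain ⟨ψ, hψ, h0⟩ := hno v.1 hv
    refine Set.mem_iUnion.2 ⟨⟨ψ, hψ⟩, ?_⟩
    change v ∈ P ⟨ψ, hψ⟩
    rw [Submodule.mem_comap, LinearMap.mem_ker, Submodule.subtype_apply, hL]
    exact h0
  obtain ⟨⟨ψ, hψ⟩, htop⟩ := Subspace.exists_eq_top_of_iUnion_eq_univ hcov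
  refine hψ (eq_of_ker_le_ker x hx fun v hv => ?_)
  have hmem : (⟨v, hv⟩ : K₀) ∈ P ⟨ψ, hψ⟩ := htop ▸ Submodule.mem_top
  exact (Submodule.mem_comap.1 hmem : _)

/-- **KOTTWITZ'S LEMMA «`V ≅ W` iff `det_V = det_W`» for `E = F`, `k = ℂ`**: for a `ℚ`-spanning family `x` of the
number field `F` and multiplicities `m, m' : Hom(F, ℂ) → ℕ`,
`∏_φ (∑ᵢ Xᵢ φ(xᵢ))^{m_φ} = ∏_φ (∑ᵢ Xᵢ φ(xᵢ))^{m'_φ}` in `ℂ[Xᵢ : i ∈ ι]` forces `m = m'` — the determinant polynomial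
`det_V = ∏_φ ℓ_φ^{m_φ}` of the `F ⊗ ℂ`-module `V = ⊕_φ ℂ_φ^{m_φ}` determines `V`. [cite: Kottwitz1992, §5 (p. 390)] -/
theorem eq_of_prod_linearForm_pow_eq (hx : Submodule.span ℚ (Set.range x) = ⊤) {m m' : (F →+* ℂ) → ℕ}
    (h : ∏ φ : F →+* ℂ, (∑ i, (MvPolynomial.X i : MvPolynomial ι ℂ) * MvPolynomial.C (φ (x i) : ℂ)) ^ m φ =
      ∏ φ : F →+* ℂ, (∑ i, (MvPolynomial.X i : MvPolynomial ι ℂ) * MvPolynomial.C (φ (x i) : ℂ)) ^ m' φ) :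
    m = m' := by
  set ℓ : (F →+* ℂ) → MvPolynomial ι ℂ :=
    fun φ => ∑ i, (MvPolynomial.X i : MvPolynomial ι ℂ) * MvPolynomial.C (φ (x i) : ℂ) with hℓ
  have hev : ∀ (φ : F →+* ℂ) (v : ι → ℂ), MvPolynomial.eval v (ℓ φ) = ∑ i, v i * φ (x i) :=
    fun φ v => eval_linearForm x φ v
  have hne : ∀ φ : F →+* ℂ, ℓ φ ≠ 0 := fun φ => linearForm_ne_zero x hx φ
  -- one factor `ℓ_{φ₀}` can be split off when `k φ₀ ≠ 0`
  have hsplit : ∀ (k : (F →+* ℂ) → ℕ) (φ₀ : F →+* ℂ), k φ₀ ≠ 0 →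
      ∏ φ, ℓ φ ^ k φ = ℓ φ₀ * ∏ φ, ℓ φ ^ Function.update k φ₀ (k φ₀ - 1) φ := by
    intro k φ₀ hk
    rw [← Finset.mul_prod_erase Finset.univ (fun φ => ℓ φ ^ k φ) (Finset.mem_univ φ₀),
      ← Finset.mul_prod_erase Finset.univ (fun φ => ℓ φ ^ Function.update k φ₀ (k φ₀ - 1) φ)
        (Finset.mem_univ φ₀)]
    simp only [Function.update_self]
    rw [← mul_assoc, ← pow_succ', Nat.sub_add_cancel (Nat.one_le_iff_ne_zero.2 hk)]
    congr 1
    exact Finset.prod_congr rfl fun φ hφ => by rw [Function.update_of_ne (Finset.ne_of_mem_erase hφ)]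
  induction hN : ∑ φ, m φ using Nat.strong_induction_on generalizing m m' with
  | _ N ih =>
    by_cases hzero : ∀ φ, m φ = 0
    · -- `m = 0`: evaluate at `0`, every `ℓ_φ(0) = 0`
      funext φ₁
      rw [hzero φ₁]
      by_contra hne'
      have hm'ne : m' φ₁ ≠ 0 := fun h0 => hne' h0.symm
      have hR : MvPolynomial.eval (0 : ι → ℂ) (∏ φ, ℓ φ ^ m' φ) = 0 := by
        rw [map_prod]
        refine Finset.prod_eq_zero (Finset.mem_univ φ₁) ?_
        rw [map_pow, hev]
        simp only [Pi.zero_apply, zero_mul, Finset.sum_const_zero]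
        exact zero_pow hm'ne
      have hL : MvPolynomial.eval (0 : ι → ℂ) (∏ φ, ℓ φ ^ m φ) = 1 := by
        rw [map_prod]
        refine Finset.prod_eq_one fun φ _ => ?_
        rw [hzero φ, pow_zero, map_one]
      rw [h, hR] at hL
      exact zero_ne_one hL
    · push Not at hzero
      obtain ⟨φ₀, hφ₀⟩ := hzero
      obtain ⟨v, hv0, hvne⟩ := exists_root_avoiding x hx φ₀
      -- the factor `ℓ_{φ₀}` occurs on the right too
      have hφ₀' : m' φ₀ ≠ 0 := by
        have hL : MvPolynomial.eval v (∏ φ, ℓ φ ^ m φ) = 0 := by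
          rw [map_prod]
          refine Finset.prod_eq_zero (Finset.mem_univ φ₀) ?_
          rw [map_pow, hev, hv0]
          exact zero_pow hφ₀
        rw [h, map_prod, Finset.prod_eq_zero_iff] at hL
        obtain ⟨φ, -, hφ⟩ := hL
        rw [map_pow, hev] at hφ
        by_cases hn : m' φ = 0
        · rw [hn, pow_zero] at hφ
          exact absurd hφ one_ne_zero
        · have hval : ∑ i, v i * φ (x i) = 0 := (pow_eq_zero_iff hn).1 hφ
          have hφeq : φ = φ₀ := by
            by_contra hne'
            exact hvne φ hne' hval
          rw [← hφeq]
          exact hn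
      -- cancel one `ℓ_{φ₀}`
      rw [hsplit m φ₀ hφ₀, hsplit m' φ₀ hφ₀'] at h
      have h' := mul_left_cancel₀ (hne φ₀) h
      have hsum : ∑ φ, Function.update m φ₀ (m φ₀ - 1) φ = N - 1 := by
        rw [Finset.sum_update_of_mem (Finset.mem_univ φ₀), Finset.sdiff_singleton_eq_erase, ← hN,
          ← Finset.add_sum_erase Finset.univ m (Finset.mem_univ φ₀)]
        omega
      have hlt : N - 1 < N := by
        have hpos : 0 < N := by
          rw [← hN, ← Finset.add_sum_erase Finset.univ m (Finset.mem_univ φ₀)]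
          omega
        omega
      have hrec := ih (N - 1) hlt h' hsum
      funext φ
      have hc := congrFun hrec φ
      by_cases hφ : φ = φ₀
      · subst hφ
        simp only [Function.update_self] at hc
        omega
      · simp only [Function.update_of_ne hφ] at hc
        exact hc

end Kottwitz

/-! ### §2 On Shimura's pair: the `Φ`-determinant condition determines `Φ` -/

namespace EndFieldFullDegree

variable {F : Type} [Field F] [NumberField F] {A : AbelianVariety ℂ}
  (ιF : F →+* A.endAlgebra) (hF : finrank ℚ F = 2 * A.dim)

omit [NumberField F] in
/-- A product over THE type as a product of indicator powers over all embeddings. [folklore] -/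
private theorem prod_coe_eq_prod_pow_ite {ι : Type} (S : Set (F →+* ℂ)) [Fintype (F →+* ℂ)]
    (f : (F →+* ℂ) → MvPolynomial ι ℂ) :
    ∏ σ : S, f σ.1 = ∏ φ, f φ ^ (if φ ∈ S then 1 else 0) := by
  rw [← Finset.prod_subtype (Finset.univ.filter (· ∈ S)) (by simp) f, Finset.prod_filter]
  refine Finset.prod_congr rfl fun φ _ => ?_
  split_ifs <;> simp

/-- **THE `Φ`-DETERMINANT CONDITION DETERMINES THE TYPE** (Kottwitz's lemma on Shimura's pair): if, for a
`ℚ`-spanning family `x` of `F` with lifts `u i ∈ End(A)` (`1 ⊗ u i = ι(x i)`) and a basis `c` of `𝔪_e/𝔪_e²`, the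
determinant polynomial `det(∑ᵢ Tᵢ [δ(u i)]_c)` equals `∏_φ (∑ᵢ Tᵢ φ(xᵢ))^{m_φ}` for some multiplicities `m`, then
`m` is the indicator of THE type `Φ = cmTypeOfPair ι hF` (every `φ ∈ Φ` with multiplicity one, no other `φ`).
[cite: Kottwitz1992, §5 (p. 390)] [cite: Howard2012, Def. 3.1.1] -/
theorem eq_indicator_of_det_sum_X_smul_eq_prod_pow {ι : Type} [Fintype ι] {x : ι → F}
    (hx : Submodule.span ℚ (Set.range x) = ⊤) {u : ι → End A}
    (hu : ∀ i, AbelianVariety.endAlgebra.of A (u i) = ιF (x i)) {n : Type} [Fintype n] [DecidableEq n]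
    (c : Basis n ℂ (Motives.AbelianVariety.Cotangent A)) {m : (F →+* ℂ) → ℕ}
    (h : (∑ i, (MvPolynomial.X i : MvPolynomial ι ℂ) •
        ((LinearMap.toMatrix c c (Motives.AbelianVariety.cotangentMap A (u i))).map MvPolynomial.C :
          Matrix n n (MvPolynomial ι ℂ))).det =
      ∏ φ : F →+* ℂ, (∑ i, (MvPolynomial.X i : MvPolynomial ι ℂ) * MvPolynomial.C (φ (x i) : ℂ)) ^ m φ) :
    m = fun φ => if φ ∈ (cmTypeOfPair ιF hF).1 then 1 else 0 := by
  rw [det_sum_X_smul_toMatrix_cotangentMap_eq_prod ιF hF hu c,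
    prod_coe_eq_prod_pow_ite (cmTypeOfPair ιF hF).1
      (fun φ => ∑ i, (MvPolynomial.X i : MvPolynomial ι ℂ) * MvPolynomial.C (φ (x i) : ℂ))] at h
  exact (eq_of_prod_linearForm_pow_eq x hx h).symm

/-- **A pair satisfying the `Ψ`-determinant condition (on a spanning family) for a set `Ψ` of embeddings has
`Ψ = Φ`** — the «CM type `Φ`» of a point of Howard's `𝒞ℳ_Φ` over `ℂ` is read off the determinant condition.
[cite: Howard2012, Def. 3.1.1 and §3.1] [cite: Kottwitz1992, §5 (p. 390)] -/
theorem eq_cmTypeOfPair_of_det_sum_X_smul_eq_prod {ι : Type} [Fintype ι] {x : ι → F}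
    (hx : Submodule.span ℚ (Set.range x) = ⊤) {u : ι → End A}
    (hu : ∀ i, AbelianVariety.endAlgebra.of A (u i) = ιF (x i)) {n : Type} [Fintype n] [DecidableEq n]
    (c : Basis n ℂ (Motives.AbelianVariety.Cotangent A)) {Ψ : Set (F →+* ℂ)}
    (h : (∑ i, (MvPolynomial.X i : MvPolynomial ι ℂ) •
        ((LinearMap.toMatrix c c (Motives.AbelianVariety.cotangentMap A (u i))).map MvPolynomial.C :
          Matrix n n (MvPolynomial ι ℂ))).det =
      ∏ σ : Ψ, (∑ i, (MvPolynomial.X i : MvPolynomial ι ℂ) * MvPolynomial.C (σ.1 (x i) : ℂ))) :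
    Ψ = (cmTypeOfPair ιF hF).1 := by
  rw [prod_coe_eq_prod_pow_ite Ψ
    (fun φ => ∑ i, (MvPolynomial.X i : MvPolynomial ι ℂ) * MvPolynomial.C (φ (x i) : ℂ))] at h
  have hm := eq_indicator_of_det_sum_X_smul_eq_prod_pow ιF hF hx hu c h
  ext φ
  have hφ : (if φ ∈ Ψ then (1 : ℕ) else 0) = if φ ∈ (cmTypeOfPair ιF hF).1 then 1 else 0 := congrFun hm φ
  constructor
  · intro h1
    by_contra h2
    rw [if_pos h1, if_neg h2] at hφ
    exact one_ne_zero hφ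
  · intro h2
    by_contra h1
    rw [if_neg h1, if_pos h2] at hφ
    exact zero_ne_one hφ

end EndFieldFullDegree

end Literature.AlgebraicGeometry.ComplexMultiplication

end
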